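import Summits.BirchSwinnertonDyer.BirchSwinnertonDyer.Theorems.ByReductionTypeAtTwoMultTransportP49KernelShapiro
import Summits.BirchSwinnertonDyer.BirchSwinnertonDyer.Theorems.ByReductionTypeAtTwoMultTransportP49KernelShapiroImage
import Literature.NumberTheory.GaloisRepresentations.GaloisCohomologyInfResProofs
import Literature.NumberTheory.GaloisRepresentations.GlobalTriangulineSpace
import HarnessLib

/-!
# T-42-mult in the kernel, XLVIII — P49-KERNEL (6b): `H¹(K_Σ/K_∞, E[p^∞]) = H¹(K_Σ/K, E[p^∞] ⊗ Λ^*(κ⁻¹))`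
# — inflation to `Γ_K` and the image of Shapiro: input (I4) of `P49Kernel.prop49_of_kernelInputs` DISCHARGED

Cell `bsd-2adic` (run/shared/lean/pub/bsd-2adic/), seat `bsd-2adic-t42` GEN 18 (pen RC-315 (b); memo
`t42/DESIGN-T42-ADDENDUM-21` §A21.3 (I4)). HONEST FRAMING: research route; THEOREMS ONLY (no `def`, no named fact,
no instance, no `sorry`); nothing booked; BSD is not proved by any of this. PARTITION: X5@2 multiplicative GV-transport
rows (K4ᵐ B1·O1; PRINT binder P49 of `multCongruenceTransportAtTwo_of_print49`) × all p — reduces-the-named-input-of;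
bears_on K4 19922 / 19923 (`--supports stmt-BirchSwinnertonDyer-19923`).

PRINT (Greenberg, LNM 1716 (1999), proof of Prop. 4.9, p. 113): "`H¹(K_Σ/K_∞, E[p^∞]) = H¹(K_Σ/K, 𝒜)`, where
`𝒜 = E[p^∞] ⊗ Λ^*(κ⁻¹)` … (Shapiro's lemma)", `Γ = Gal(K_∞/K)` acting on the left through `γ ↦ 1 + T`. The kernel
theorem `P49Kernel.prop49_of_kernelInputs` (file XLIII) consumes this as its input (I4): an additive bijection
`Sh : H¹(G_{K,S}, 𝒜) ≃ unramifiedOutside (ker κ) E[p^∞] p S₀` (Greenberg–Vatsal's place-by-place `H¹(K_Σ/K_∞, E[p^∞])`,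
`Σ = S₀ ∪ {p, ∞}`) carrying Greenberg's twists `θ_u = u(1+T) − 1` to `u·conj_γ − 1`. This file CONSTRUCTS it, for every
number field `K` and every prime `p` (no parity, no `K` totally complex):

* (file 6a, `…P49KernelShapiroImage`) THE IMAGE OF SHAPIRO: for a cocycle `c` of `Γ_K` in `𝒜_Γ` with Shapiro cocycle
  `z = (h ↦ c(h)(0))`: `c|_{N_S} = 0 ⟺ [z] ∈ unramifiedOutside (ker κ) E[p^∞] p S₀` (`S = S₀ ∪ {v ∣ p}`).
* (here) `exists_shapiro_bridge` — inflation `H¹(G_{K,S}, 𝒜) ↪ H¹(Γ_K, 𝒜_Γ)` (identity on the module; injective with image the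
  classes of cocycles vanishing on `N_S`: the tree's `ContinuousCohomology.inf_one_injective` / `exact_inf_res_one`,
  NSW (1.6.7)) followed by the oriented Shapiro bijection of file XLVII (`exists_shapiro_addEquiv_twist`); `Λ`-linearity
  of inflation transports `θ_u`. `bigRep_lift_mk_apply`: the instance `𝒜 = bigRep κ̄ ρ₀` of the kernel files.

What remains for `prop49_of_kernelInputs` after this file: (I1) LEO — the corank count `corank_Λ H¹ = [K:ℚ]`,
`corank_Λ H² = 0` for `𝒜` over `G_{K,S}` (Prop. 4.1-type Euler characteristic with the real place; `X(E/K_∞)` torsion).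

References: [GreenbergLNM1716] proof of Prop. 4.9 p. 113; [GreenbergVatsal2000] §2 pp. 16–17, 23;
[NeukirchSchmidtWingberg2008] (1.6.7), VIII §3; [SkinnerUrban2014] §3.1.1–3.1.2, Prop. 3.2.3; [NeukirchANT1999] I §9, II §9;
[Washington1997] Prop. 13.2; [Greenberg2006] p. 341 L39 – p. 342 L4.
-/

set_option autoImplicit false
set_option linter.dupNamespace false

noncomputable section

open scoped Classical

namespace Summit.BirchSwinnertonDyer.BirchSwinnertonDyer.Theorems.P49Kernel

open Multiplicative Field IsDedekindDomain NumberField WeierstrassCurve CategoryTheory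
open Literature.NumberTheory.EllipticCurves Literature.NumberTheory.EllipticCurves.BigGaloisRep
  Literature.NumberTheory.EllipticCurves.GreenbergSelmer Literature.NumberTheory.EllipticCurves.GreenbergVatsal2000
  Literature.NumberTheory.GaloisRepresentations

/-! ## §4. Inflation `H¹(G_{K,S}, 𝒜) ↪ H¹(Γ_K, 𝒜_Γ)` and the bridge `Sh` -/

section Bridge

variable {K : Type} [Field K] [NumberField K] (W : WeierstrassCurve K) {p : ℕ} [Fact p.Prime]
  (κ : ZpExtension K p) (γ : absoluteGaloisGroup K)
  {S S₀ : Set (HeightOneSpectrum (𝓞 K))}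
  [TopologicalSpace (PowerSeries ℤ_[p])]
  [ContinuousSMul (PowerSeries ℤ_[p]) (BigRepModule ℤ_[p] p (PrimaryTorsion W.geomPoints p))]

omit [ContinuousSMul (PowerSeries ℤ_[p]) (BigRepModule ℤ_[p] p (PrimaryTorsion W.geomPoints p))] in
/-- The co-induced module on `G_{K,S}` built from the DESCENDED data `(κ̄, ρ₀)` inflates to `𝒜_Γ`:
`bigRep κ̄ ρ₀ (σ mod N_S) = AnticyclotomicBigGaloisRep κ ρ_{E,p} σ` whenever `ρ₀(σ mod N_S) = σ` on `E[p^∞]`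
(`κ̄(σ mod N_S) = κ σ` holds by `rfl`, `ZpExtension.liftUnramifiedOutside_mk`). [cite: Greenberg2006, p. 342 L2–4]
[cite: Castella2018, §2.1 (𝒜 := T ⊗ Λ^*, action ρ ⊗ Ψ^{-1})] -/
theorem bigRep_lift_mk_apply (hSp : ∀ v : HeightOneSpectrum (𝓞 K), ((p : ℕ) : 𝓞 K) ∈ v.asIdeal → v ∈ S)
    (ρ₀ : ContinuousRep (GaloisGroupUnramifiedOutside K S) ℤ_[p] (PrimaryTorsion W.geomPoints p))
    (hρ₀ : ∀ (σ : absoluteGaloisGroup K) (P : PrimaryTorsion W.geomPoints p), ρ₀ (toUnramifiedQuot K S σ) P = σ • P)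
    (σ : absoluteGaloisGroup K) (Φ : BigRepModule ℤ_[p] p (PrimaryTorsion W.geomPoints p)) :
    bigRep (κ.liftUnramifiedOutside S hSp) ρ₀ (toUnramifiedQuot K S σ) Φ =
      AnticyclotomicBigGaloisRep κ (W.primaryTorsionGaloisRep p) σ Φ := by
  refine BigRepModule.ext fun x ↦ ?_
  change bigRep (κ.liftUnramifiedOutside S hSp) ρ₀ (toUnramifiedQuot K S σ) Φ x =
    bigRep κ.toContinuousMonoidHom (W.primaryTorsionGaloisRep p) σ Φ x
  rw [bigRep_apply_apply, bigRep_apply_apply, hρ₀, ZpExtension.liftUnramifiedOutside_mk]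
  rfl

/-- **THE SHAPIRO BRIDGE `H¹(G_{K,S}, E[p^∞] ⊗ Λ^*(κ⁻¹)) ≃ H¹(K_Σ/K_∞, E[p^∞])`, oriented `θ_u ↦ u·conj_γ − 1`** — input
(I4) of `P49Kernel.prop49_of_kernelInputs`, for every number field `K`, every prime `p`, every `ℤ_p`-extension `κ` with
topological generator `γ`, `S = S₀ ∪ {v ∣ p}` with `N_S` fixing `E[p^∞]` (e.g. `S ⊇` the bad places), and every
continuous `Λ`-linear `𝒜` on `G_{K,S}` inflating to `𝒜_Γ` (e.g. `bigRep κ̄ ρ₀`, `bigRep_lift_mk_apply`). Construction: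
inflation `H¹(G_{K,S}, 𝒜) → H¹(Γ_K, 𝒜_Γ)` (injective, image `= ker(res to N_S) =` the classes of cocycles vanishing on
`N_S`: `exact_inf_res_one`, `inf_one_injective`, `N_S` acting trivially), followed by Shapiro's oriented bijection onto
`H¹(K_∞, E[p^∞])` (file XLVII); its image is `unramifiedOutside (ker κ) E[p^∞] p S₀` by §3. Greenberg: "by Shapiro's
lemma `H¹(K_Σ/K_∞, E[p^∞]) = H¹(K_Σ/K, 𝒜)`", with `Γ` acting through `γ ↦ 1 + T`.
[cite: GreenbergLNM1716, proof of Prop. 4.9 p. 113] [cite: NeukirchSchmidtWingberg2008, (1.6.7), VIII §3]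
[cite: GreenbergVatsal2000, §2 pp. 16, 23] [cite: SkinnerUrban2014, Prop. 3.2.3 (proof)] -/
theorem exists_shapiro_bridge (hγ : κ.IsTopGenerator γ)
    (hS₀ : S₀ ⊆ S) (hSp : ∀ v : HeightOneSpectrum (𝓞 K), ((p : ℕ) : 𝓞 K) ∈ v.asIdeal → v ∈ S)
    (hSle : ∀ v : HeightOneSpectrum (𝓞 K), v ∉ S₀ → ((p : ℕ) : 𝓞 K) ∉ v.asIdeal → v ∉ S)
    (hNS : ∀ n ∈ ramificationSubgroup K S, ∀ P : PrimaryTorsion W.geomPoints p, n • P = P)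
    (𝒜 : ContinuousRep (GaloisGroupUnramifiedOutside K S) (PowerSeries ℤ_[p])
      (BigRepModule ℤ_[p] p (PrimaryTorsion W.geomPoints p)))
    (h𝒜 : ∀ (σ : absoluteGaloisGroup K) (Φ : BigRepModule ℤ_[p] p (PrimaryTorsion W.geomPoints p)),
      𝒜 (toUnramifiedQuot K S σ) Φ = AnticyclotomicBigGaloisRep κ (W.primaryTorsionGaloisRep p) σ Φ) :
    ∃ Sh : 𝒜.H 1 ≃+ unramifiedOutside κ.kerSubgroup ↥(W.geomPrimaryTorsion p) p S₀,
      ∀ (u : ℤ) (x : 𝒜.H 1),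
        ((Sh ((PowerSeries.C (u : ℤ_[p]) * PowerSeries.X + PowerSeries.C ((u : ℤ_[p]) - 1) :
            PowerSeries ℤ_[p]) • x) : unramifiedOutside κ.kerSubgroup ↥(W.geomPrimaryTorsion p) p S₀) :
            W.subgroupH1 p κ.kerSubgroup) =
          u • W.conjH1 p κ.kerSubgroup γ (Sh x) - Sh x := by
  classical
  -- the `Γ_K`-module `𝒜_Γ` and the Shapiro bijection with its orientation (file XLVII)
  let X : TopRep (PowerSeries ℤ_[p]) (absoluteGaloisGroup K) :=
    (AnticyclotomicBigGaloisRep κ (W.primaryTorsionGaloisRep p)).toTopRep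
  obtain ⟨e, hez, -, hetw⟩ := exists_shapiro_addEquiv_twist W p κ γ hγ
  have hXN : ∀ n ∈ ramificationSubgroup K S, ∀ m : X, X.ρ n m = m := fun n hn m ↦
    anticyclotomicBigGaloisRep_apply_of_mem_ramificationSubgroup W κ hSp hNS hn m
  -- inflation along `Γ_K ↠ G_{K,S}`: the identity of the module is equivariant by `h𝒜`
  let N : Subgroup (absoluteGaloisGroup K) := ramificationSubgroup K S
  let ι : TopRep.res (ContinuousMonoidHom.quotientMk N :
      absoluteGaloisGroup K →* GaloisGroupUnramifiedOutside K S) 𝒜.toTopRep ⟶ X :=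
    TopRep.ofHom ⟨ContinuousLinearMap.id (PowerSeries ℤ_[p]) _, fun g ↦
      ContinuousLinearMap.ext fun Φ ↦ h𝒜 g Φ⟩
  have hιinj : Function.Injective ι.hom := fun a b h ↦ h
  have hιS : ∀ m : X, (∀ s ∈ N, X.ρ s m = m) → m ∈ Set.range ι.hom := fun m _ ↦ ⟨m, rfl⟩
  let inf : 𝒜.H 1 →ₗ[PowerSeries ℤ_[p]] (continuousCohomology 1 X : TopModuleCat (PowerSeries ℤ_[p])) :=
    (ContinuousCohomology.map (ContinuousMonoidHom.quotientMk N) ι 1).hom.toLinearMap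
  have hinf : Function.Injective inf := fun a b h ↦
    ContinuousCohomology.inf_one_injective N ι hιinj hιS h
  -- restriction to `N_S` and the inflation–restriction sequence
  let φ : N →ₜ* absoluteGaloisGroup K := ⟨N.subtype, continuous_subtype_val⟩
  let f : TopRep.res (φ : N →* absoluteGaloisGroup K) X ⟶ TopRep.res (φ : N →* absoluteGaloisGroup K) X := 𝟙 _
  have hexact := ContinuousCohomology.exact_inf_res_one N ι φ f hιinj
    (show Topology.IsInducing ι.hom from Topology.IsInducing.id) hιS (fun h ↦ h.2)
    (fun s hs ↦ ⟨⟨s, hs⟩, rfl⟩) (show Function.Bijective f.hom from Function.bijective_id)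
    (fun m ↦ (AnticyclotomicBigGaloisRep κ (W.primaryTorsionGaloisRep p)).continuous_apply_left m)
  -- the image of inflation: classes of cocycles vanishing on `N_S`
  have hrange : ∀ c : contOneCocycles X,
      oneCocycleClass X c ∈ Set.range inf ↔
        ∀ n ∈ ramificationSubgroup K S,
          (c.1 n : BigRepModule ℤ_[p] p (PrimaryTorsion (geomPoints W) p)) = 0 := by
    intro c
    have h1 : (ContinuousCohomology.map φ f 1).hom (oneCocycleClass X c) =
        oneCocycleClass _ (contOneCocycles.pullback φ f c) := map_oneCocycleClass X φ f c
    have key : (ContinuousCohomology.map φ f 1).hom (oneCocycleClass X c) = 0 ↔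
        ∀ n ∈ ramificationSubgroup K S,
          (c.1 n : BigRepModule ℤ_[p] p (PrimaryTorsion (geomPoints W) p)) = 0 := by
      rw [h1, oneCocycleClass_eq_zero_iff]
      constructor
      · rintro ⟨m, hm⟩ n hn
        have h := hm ⟨n, hn⟩
        rw [contOneCocycles.pullback_apply] at h
        change (c.1 n : BigRepModule ℤ_[p] p (PrimaryTorsion (geomPoints W) p)) = X.ρ n m - m at h
        rw [h, hXN n hn m, sub_self]
      · intro h
        refine ⟨0, fun n ↦ ?_⟩
        rw [map_zero, sub_zero, contOneCocycles.pullback_apply]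
        exact h n n.2
    exact (hexact _).symm.trans key
  -- the composite `F = e ∘ inf` is injective with image `unramifiedOutside (ker κ) E[p^∞] p S₀`
  let F : 𝒜.H 1 →+ W.subgroupH1 p κ.kerSubgroup := e.toAddMonoidHom.comp inf.toAddMonoidHom
  have hFapply : ∀ x, F x = e (inf x) := fun _ ↦ rfl
  have hFinj : Function.Injective F := e.injective.comp hinf
  have hFmem : ∀ x, F x ∈ unramifiedOutside κ.kerSubgroup ↥(W.geomPrimaryTorsion p) p S₀ := by
    intro x
    obtain ⟨c, hc⟩ := oneCocycleClass_surjective X (inf x)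
    obtain ⟨z, hz⟩ := exists_shapiro_cocycle_geomPrimaryTorsion W κ c
    rw [hFapply, ← hc, hez c z hz]
    exact shapiro_mem_unramifiedOutside_of_apply_eq_zero W κ hSle c ((hrange c).1 ⟨x, hc.symm⟩) z hz
  have hFsurj : ∀ w ∈ unramifiedOutside κ.kerSubgroup ↥(W.geomPrimaryTorsion p) p S₀, ∃ x, F x = w := by
    intro w hw
    obtain ⟨c, hc⟩ := oneCocycleClass_surjective X (e.symm w)
    obtain ⟨z, hz⟩ := exists_shapiro_cocycle_geomPrimaryTorsion W κ c
    have hw' : oneCocycleClass _ z = w := by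
      rw [← hez c z hz, hc, AddEquiv.apply_symm_apply]
    rw [← hw'] at hw
    obtain ⟨x, hx⟩ := (hrange c).2
      (apply_eq_zero_of_shapiro_mem_unramifiedOutside W κ hS₀ hSp hNS c z hz hw)
    exact ⟨x, by rw [hFapply, hx, hc, AddEquiv.apply_symm_apply]⟩
  let Fc : 𝒜.H 1 →+ unramifiedOutside κ.kerSubgroup ↥(W.geomPrimaryTorsion p) p S₀ := F.codRestrict _ hFmem
  have hFc : Function.Bijective Fc :=
    ⟨fun a b h ↦ hFinj (congrArg Subtype.val h), fun w ↦ by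
      obtain ⟨x, hx⟩ := hFsurj w.1 w.2
      exact ⟨x, Subtype.ext hx⟩⟩
  refine ⟨AddEquiv.ofBijective Fc hFc, fun u x ↦ ?_⟩
  change F ((PowerSeries.C (u : ℤ_[p]) * PowerSeries.X + PowerSeries.C ((u : ℤ_[p]) - 1) :
      PowerSeries ℤ_[p]) • x) = u • W.conjH1 p κ.kerSubgroup γ (F x) - F x
  rw [hFapply, hFapply, map_smul, hetw]

end Bridge

end Summit.BirchSwinnertonDyer.BirchSwinnertonDyer.Theorems.P49Kernel

end
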